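import Literature.AlgebraicGeometry.Frobenioids.ArchimedeanProp35iiToyBase
import Literature.AlgebraicGeometry.Frobenioids.ArchimedeanPseudoTerminal
import Literature.AlgebraicGeometry.Frobenioids.ArchimedeanIsotropy
import Literature.AlgebraicGeometry.Frobenioids.FiberProductsMorphisms
import HarnessLib

/-!
# The three-object base `T → D₀` of `ArchimedeanProp35iiToyBase.lean`: categorical quotients and the
# RC-structure (it is of RC-iso-subanchor type for the constant functor at `Spec ℂ`)

Mochizuki, *The geometry of Frobenioids II: poly-Frobenioids*, Kyushu J. Math. **62** (2008)
401–460, §3, Def. 3.1 (v) p. 25 (RC-anchors, RC-subanchors, RC-iso-subanchors, RC-iso-subanchor type)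
[cite: MochizukiFrdII2008, Def 3.1 (v) p.25] and Prop. 3.5 (ii) p. 34 [cite: MochizukiFrdII2008, Prop 3.5 (ii) p.34];
[FrdI] §0 p. 18 (categorical quotients, mono-minimal quotients, anchors) [cite: MochizukiFrdI2008, §0 p.18].

Second half of the toy base (seat abc-iut-f-014, block F of the abc-iut cell, FACT-LIST rows
F-0861/F-0862; split only for the 400-line file limit). PROVED here, all by finite case analysis:

* `T.isIso_of_mono_from_c` — a monomorphism out of the free orbit `c` is an isomorphism;
* `T.isMonoMinimalQuotient_top_quot` — `c → p` is a mono-minimal categorical quotient of `c` by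
  `Aut(c) = {1, σ}`; `T.isMonoMinimalQuotient_bot_id_c` / `_e` — the identities of `c`, `e` are
  mono-minimal categorical quotients by the trivial group (no total epimorphicity is used: a
  factorisation of an identity through `A'` is pinned down by the shapes of arrows);
* `toD0 : T → D₀`, the CONSTANT functor at `Spec ℂ`; every object is complex; no arrow of `T[ℂ] = T` is
  irreducible, so every object is an RC-anchor; **`isOfRCIsoSubanchorType_toD0`**: `T` is of
  RC-iso-subanchor type for `toD0 ⋙ toArchBase` ([FrdII] Def. 3.1 (v));
* the unit objects `unitC x = (tip-1 isotropic region over Spec ℂ, x)` of `C_{toD0} = C₀ ×_{D₀} T`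
  (= `unitObjOver toD0 x` of `ArchimedeanPseudoTerminal.lean`, spelled as reducible literals), the arrows
  `unitHom g = (1, g)` between them (isometries) and the swap `swapC = (1, σ)` of `unitC c`, and the
  same data in the angular Frobenioid `A ⊆ C` (`unitA`, `unitHomA`, `swapA`) — the objects and arrows
  of the counterexample of `ArchimedeanProp35iiCounterexample.lean`; the unit objects are ISOTROPIC
  (`isIsotropic_unitC`, `isIsotropic_unitA`, via Ex. 3.3 (ii)/(iii)).

No `Prop`-valued fact is introduced; nothing here bears on [IUTchIII] Cor. 3.12; typed ≠ proved except
where a `theorem` says so.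
-/

namespace Literature.AlgebraicGeometry.Frobenioids

open CategoryTheory

namespace ArchFrd

namespace P35iiToy

namespace T

/-! ### Categorical quotients in `T` ([FrdI] §0) -/

/-- A monomorphism out of `c` is an isomorphism: the two non-trivial targets `p`, `e` only receive
`σ`-invariant arrows from `c`. [cite: MochizukiFrdI2008, §0 p.18] -/
theorem isIso_of_mono_from_c {Y : T} (ζ : c ⟶ Y) [Mono ζ] : IsIso ζ := by
  cases Y with
  | c => exact isIso_hom_cc ζ
  | p =>
    exfalso
    exact sw_ne_id ((cancel_mono ζ).mp (Subsingleton.elim (sw ≫ ζ) (𝟙 c ≫ ζ)))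
  | e =>
    exfalso
    obtain ⟨i, rfl⟩ := hom_ce_eq ζ
    have h1 : sw ≫ cst i = 𝟙 c ≫ cst i := by rw [sw_comp_cst, Category.id_comp]
    exact sw_ne_id ((cancel_mono (cst i)).mp h1)

/-- `σ` moves every arrow `c → c` (the action of `Aut(c)` on itself is free).
[cite: MochizukiFrdI2008, §0 p.18] -/
theorem sw_comp_ne_self (φ : c ⟶ c) : sw ≫ φ ≠ φ := by
  obtain ⟨s, rfl⟩ := hom_cc_eq φ
  rw [sw_eq, au_comp_au]
  intro h
  have h' := Hom.auto.inj (show Hom.auto (xor true s) = Hom.auto s from h)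
  revert h'
  cases s <;> decide

/-- `c → p` is a categorical quotient of `c` by the full group `Aut(c) = {1, σ}`: a `σ`-invariant arrow
out of `c` goes to `p` or `e` and factors uniquely through `c → p`. [cite: MochizukiFrdI2008, §0 p.18] -/
theorem isCategoricalQuotient_top_quot : IsCategoricalQuotient (⊤ : Subgroup (Aut c)) quot := by
  refine ⟨fun γ _ => Subsingleton.elim _ _, fun X ψ hψ => ?_⟩
  have hsw : sw ≫ ψ = ψ := hψ swIso (Subgroup.mem_top _)
  cases X with
  | c => exact (sw_comp_ne_self ψ hsw).elim
  | p => exact ⟨𝟙 p, Subsingleton.elim _ _, fun _ _ => Subsingleton.elim _ _⟩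
  | e =>
    obtain ⟨i, rfl⟩ := hom_ce_eq ψ
    refine ⟨sec i, quot_comp_sec i, fun ψ' hψ' => ?_⟩
    obtain ⟨j, rfl⟩ := hom_pe_eq ψ'
    rw [quot_comp_sec] at hψ'
    rw [cst_injective hψ']

/-- **`c → p` is a MONO-MINIMAL categorical quotient of `c` by `Aut(c)`** (every monomorphism out of
`c` is an isomorphism). [cite: MochizukiFrdI2008, §0 p.18] -/
theorem isMonoMinimalQuotient_top_quot : IsMonoMinimalQuotient (⊤ : Subgroup (Aut c)) quot :=
  ⟨isCategoricalQuotient_top_quot, fun _ ζ _ _ _ _ => isIso_of_mono_from_c ζ⟩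

/-- The identity of `c` is a mono-minimal categorical quotient of `c` by the trivial group (a
factorisation `c → A' → c` forces `A' = c`). [cite: MochizukiFrdI2008, §0 p.18] -/
theorem isMonoMinimalQuotient_bot_id_c : IsMonoMinimalQuotient (⊥ : Subgroup (Aut c)) (𝟙 c) := by
  refine ⟨⟨fun γ hγ => ?_, fun X ψ _ => ⟨ψ, Category.id_comp ψ, fun ψ' hψ' => ?_⟩⟩,
    fun A' ζ φ' _ _ _ => ?_⟩
  · rw [Subgroup.mem_bot] at hγ
    subst hγ
    exact Category.id_comp _
  · rw [← hψ', Category.id_comp]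
  · cases A' with
    | c => exact isIso_hom_cc ζ
    | p => exact (isEmpty_hom_pc.false φ').elim
    | e => exact (isEmpty_hom_ec.false φ').elim

/-- The identity of `e` is a mono-minimal categorical quotient of `e` by the trivial group (a
factorisation `e → A' → e` of the identity has `A' = e` and an injective, hence bijective, first factor).
[cite: MochizukiFrdI2008, §0 p.18] -/
theorem isMonoMinimalQuotient_bot_id_e : IsMonoMinimalQuotient (⊥ : Subgroup (Aut e)) (𝟙 e) := by
  refine ⟨⟨fun γ hγ => ?_, fun X ψ _ => ⟨ψ, Category.id_comp ψ, fun ψ' hψ' => ?_⟩⟩,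
    fun A' ζ φ' hfac _ _ => ?_⟩
  · rw [Subgroup.mem_bot] at hγ
    subst hγ
    exact Category.id_comp _
  · rw [← hψ', Category.id_comp]
  · cases A' with
    | c => exact (isEmpty_hom_ec.false ζ).elim
    | p =>
      exfalso
      obtain ⟨i, rfl⟩ := hom_pe_eq φ'
      rw [Subsingleton.elim ζ ret, ret_comp_sec, id_e] at hfac
      exact const_ne_id i (emap_injective hfac)
    | e =>
      obtain ⟨g, rfl⟩ := hom_ee_eq ζ
      obtain ⟨g', rfl⟩ := hom_ee_eq φ'
      exact isIso_emap_of_comp_eq_id hfac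

end T

/-! ### The functor `T → D₀` and the RC-structure -/

/-- **The base functor `toD0 : T → D₀`**: the CONSTANT functor at `Spec ℂ` (every object complex, every
arrow the identity of `Spec ℂ`). [cite: MochizukiFrdII2008, Ex 3.3 (i) p.28] -/
def toD0 : T ⥤ D0 := (Functor.const T).obj D0.complex

/-- `toD0` on objects. [cite: MochizukiFrdII2008, Ex 3.3 (i) p.28] -/
@[simp] theorem toD0_obj (X : T) : toD0.obj X = D0.complex := rfl

/-- `toD0` on arrows. [cite: MochizukiFrdII2008, Ex 3.3 (i) p.28] -/
@[simp] theorem toD0_map {X Y : T} (φ : X ⟶ Y) : toD0.map φ = 𝟙 D0.complex := rfl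

/-- Every object of `T` is complex for `T → D₀ → ArchBase`. [cite: MochizukiFrdII2008, Def 3.1 (v) p.24] -/
theorem complexObjects (X : T) : RC.complexObjects (toD0 ⋙ D0.toArchBase) X :=
  (D0.complexObjects_comp_iff toD0 X).mpr rfl

/-- No arrow of the full subcategory `T[ℂ]` (= all of `T`) is irreducible: a factorisation in `T`
through two non-isomorphisms is one in `T[ℂ]`. [cite: MochizukiFrdII2008, Def 3.1 (v) p.25] -/
theorem not_isIrreducibleHom_complexPart {X Y : RC.ComplexPart (toD0 ⋙ D0.toArchBase)} (φ : X ⟶ Y) :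
    ¬ IsIrreducibleHom φ := by
  intro h
  rcases T.iso_or_reducible φ.hom with hφ | ⟨Z, β, α, hfac, hβ, hα⟩
  · apply h.1
    haveI := hφ
    haveI : IsIso ((RC.complexObjects (toD0 ⋙ D0.toArchBase)).ι.map φ) := hφ
    exact isIso_of_fully_faithful (RC.complexObjects (toD0 ⋙ D0.toArchBase)).ι φ
  · let Z' : RC.ComplexPart (toD0 ⋙ D0.toArchBase) := ⟨Z, complexObjects Z⟩
    let β' : X ⟶ Z' := ObjectProperty.homMk β
    let α' : Z' ⟶ Y := ObjectProperty.homMk α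
    have hfac' : β' ≫ α' = φ := ObjectProperty.hom_ext _ hfac
    rcases h.2 β' α' hfac' with hα' | hβ'
    · exact hα (show IsIso α'.hom from inferInstance)
    · exact hβ (show IsIso β'.hom from inferInstance)

/-- Every object of `T` is an RC-anchor (complex, and an anchor of `T[ℂ]`: no irreducible arrows at all).
[cite: MochizukiFrdII2008, Def 3.1 (v) p.25] -/
theorem isRCAnchor (X : T) : RC.IsRCAnchor (toD0 ⋙ D0.toArchBase) X := by
  refine ⟨complexObjects X, Set.Finite.subset Set.finite_empty ?_⟩
  rintro x ⟨f, hf, -⟩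
  exact (not_isIrreducibleHom_complexPart f.hom hf).elim

/-- Every object of `T` is an RC-subanchor (via its identity). [cite: MochizukiFrdII2008, Def 3.1 (v) p.25] -/
theorem isRCSubanchor (X : T) : RC.IsRCSubanchor (toD0 ⋙ D0.toArchBase) X :=
  ⟨X, isRCAnchor X, ⟨𝟙 X⟩⟩

/-- **`T → D₀` is of RC-iso-subanchor type** ([FrdII] Def. 3.1 (v)): `c` and `e` via their identities
(quotients by the trivial group), `p` via the mono-minimal categorical quotient `c → p` of `c` by
`Aut(c)`. [cite: MochizukiFrdII2008, Def 3.1 (v) p.25] -/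
theorem isOfRCIsoSubanchorType_toD0 : RC.IsOfRCIsoSubanchorType (toD0 ⋙ D0.toArchBase) := by
  refine ⟨fun X => ?_⟩
  cases X with
  | c => exact ⟨T.c, ⊥, 𝟙 T.c, isRCSubanchor T.c, T.isMonoMinimalQuotient_bot_id_c⟩
  | p => exact ⟨T.c, ⊤, T.quot, isRCSubanchor T.c, T.isMonoMinimalQuotient_top_quot⟩
  | e => exact ⟨T.e, ⊥, 𝟙 T.e, isRCSubanchor T.e, T.isMonoMinimalQuotient_bot_id_e⟩

/-! ### The unit objects of `C = C₀ ×_{D₀} T` over the toy base and the arrows `(1, g)` -/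

noncomputable section

/-- The object of `C_{toD0} = C₀ ×_{D₀} T` over `x ∈ Ob(T)` with the tip-`1` ISOTROPIC angular region
over `Spec ℂ` (the object `unitObjOver toD0 x`, spelled as a literal so that its components reduce).
[cite: MochizukiFrdII2008, Ex 3.3 (i) p.28] -/
abbrev unitC (x : T) : C toD0 := ⟨C0.unitObj D0.complex, x, Iso.refl _⟩

/-- Over the CONSTANT base functor the compatibility square of an arrow `(1, g)` between unit objects
holds automatically. [cite: MochizukiFrdII2008, Ex 3.3 (i) p.28] -/
theorem w_unit {x y : T} (g : x ⟶ y) :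
    (PreFrobenioid.baseFunctor C0.toElem).map (𝟙 (C0.unitObj D0.complex)) ≫ (unitC y).iso.hom =
      (unitC x).iso.hom ≫ toD0.map g := by
  rw [CategoryTheory.Functor.map_id]
  rfl

/-- The arrow `(1, g) : unitC x → unitC y` of `C` over an arrow `g` of `T` (the `C₀`-part is the
identity: the base functor is constant, so the two parts of an arrow of `C₀ ×_{D₀} T` are decoupled).
[cite: MochizukiFrdII2008, Ex 3.3 (i) p.28] -/
abbrev unitHom {x y : T} (g : x ⟶ y) : unitC x ⟶ unitC y := ⟨𝟙 _, g, w_unit g⟩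

/-- `(1, g) ≫ (1, h) = (1, g ≫ h)`. [cite: MochizukiFrdII2008, Ex 3.3 (i) p.28] -/
@[simp] theorem unitHom_comp {x y z : T} (g : x ⟶ y) (h : y ⟶ z) :
    unitHom g ≫ unitHom h = unitHom (g ≫ h) :=
  CFP.hom_ext (Category.id_comp _) rfl

/-- `(1, 1) = 1`. [cite: MochizukiFrdII2008, Ex 3.3 (i) p.28] -/
@[simp] theorem unitHom_id (x : T) : unitHom (𝟙 x) = 𝟙 (unitC x) := rfl

/-- The arrows `(1, g)` are isometries of `C` (so they are arrows of the angular Frobenioid `A ⊆ C`).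
[cite: MochizukiFrdII2008, Ex 3.3 (iii) p.29] -/
theorem isIsometry_unitHom {x y : T} (g : x ⟶ y) : PreFrobenioid.IsIsometry (C.toElem toD0) (unitHom g) :=
  (PreFrobenioid.isIsometry_fiberProduct_iff _).2 (PreFrobenioid.div_id C0.toElem _)

/-- The unit objects are ISOTROPIC objects of `C` (Ex. 3.3 (ii): isotropic = naively isotropic, and the
tip-`1` region is isotropic). [cite: MochizukiFrdII2008, Ex 3.3 (ii) p.28] -/
theorem isIsotropic_unitC (x : T) : PreFrobenioid.IsIsotropic (C.toElem toD0) (unitC x) :=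
  (Ex33ii_isotropic_iff_holds toD0 _).2 (AngularRegion.isIsotropic_isotropicOfTip 1)

/-- **The swap `σ_B := (1, σ)`**, an automorphism of the unit object over the free orbit `c` with trivial
`C₀`-part. [cite: MochizukiFrdII2008, Ex 3.3 (i) p.28] -/
def swapC : unitC T.c ≅ unitC T.c := CFP.isoMk (Iso.refl _) T.swIso (w_unit T.sw)

/-- The `C₀`-part of `σ_B` is the identity. [cite: MochizukiFrdII2008, Ex 3.3 (i) p.28] -/
@[simp] theorem swapC_hom_fst : swapC.hom.fst = 𝟙 _ := rfl

/-- The `T`-part of `σ_B` is `σ`. [cite: MochizukiFrdII2008, Ex 3.3 (i) p.28] -/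
@[simp] theorem swapC_hom_snd : swapC.hom.snd = T.sw := rfl

/-- `σ_B` is the arrow `(1, σ)`. [cite: MochizukiFrdII2008, Ex 3.3 (i) p.28] -/
theorem swapC_hom : swapC.hom = unitHom T.sw := rfl

/-- `σ_B ≠ 1`. [cite: MochizukiFrdII2008, Ex 3.3 (i) p.28] -/
theorem swapC_hom_ne_id : swapC.hom ≠ 𝟙 (unitC T.c) := fun h =>
  T.sw_ne_id (congrArg CFP.Hom.snd h)

/-! ### The same objects and arrows in the angular Frobenioid `A ⊆ C` (isometries) -/

/-- The unit object over `x` as an object of the angular Frobenioid `A ⊆ C` (Ex. 3.3 (iii)).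
[cite: MochizukiFrdII2008, Ex 3.3 (iii) p.28] -/
abbrev unitA (x : T) : A toD0 := ⟨unitC x⟩

/-- `(1, g)` as an arrow of `A` (it is an isometry of `C`). [cite: MochizukiFrdII2008, Ex 3.3 (iii) p.28] -/
abbrev unitHomA {x y : T} (g : x ⟶ y) : unitA x ⟶ unitA y := ⟨unitHom g, isIsometry_unitHom g⟩

/-- `(1, g) ≫ (1, h) = (1, g ≫ h)` in `A`. [cite: MochizukiFrdII2008, Ex 3.3 (iii) p.28] -/
@[simp] theorem unitHomA_comp {x y z : T} (g : x ⟶ y) (h : y ⟶ z) :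
    unitHomA g ≫ unitHomA h = unitHomA (g ≫ h) :=
  WideSubcategory.hom_ext _ (unitHom_comp g h)

/-- `(1, 1) = 1` in `A`. [cite: MochizukiFrdII2008, Ex 3.3 (iii) p.28] -/
@[simp] theorem unitHomA_id (x : T) : unitHomA (𝟙 x) = 𝟙 (unitA x) := rfl

/-- **The swap `σ_B = (1, σ)` as an automorphism of the unit object over `c` in `A`.**
[cite: MochizukiFrdII2008, Ex 3.3 (iii) p.28] -/
def swapA : unitA T.c ≅ unitA T.c where
  hom := unitHomA T.sw
  inv := unitHomA T.sw
  hom_inv_id := by rw [unitHomA_comp, T.sw_comp_sw, unitHomA_id]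
  inv_hom_id := by rw [unitHomA_comp, T.sw_comp_sw, unitHomA_id]

/-- `σ_B` in `A` is the arrow `(1, σ)`. [cite: MochizukiFrdII2008, Ex 3.3 (iii) p.28] -/
theorem swapA_hom : swapA.hom = unitHomA T.sw := rfl

/-- `σ_B ≠ 1` in `A`. [cite: MochizukiFrdII2008, Ex 3.3 (iii) p.28] -/
theorem swapA_hom_ne_id : swapA.hom ≠ 𝟙 (unitA T.c) := fun h =>
  T.sw_ne_id (congrArg (fun k => k.hom.snd) h)

/-- The unit objects are ISOTROPIC objects of `A` (Ex. 3.3 (iii): the isotropic objects of `A` are those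
of `C`). [cite: MochizukiFrdII2008, Ex 3.3 (iii) p.29] -/
theorem isIsotropic_unitA (x : T) : PreFrobenioid.IsIsotropic (A.toElem toD0) (unitA x) :=
  (Ex33iii_isotropic_iff_holds toD0 _).2 (isIsotropic_unitC x)

end

end P35iiToy

end ArchFrd

end Literature.AlgebraicGeometry.Frobenioids
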